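import Literature.Analysis.FluidPDE.CKNLocalRegularityRRSGlueLR
import HarnessLib

/-!
# The unforced one-scale ε-regularity criterion in Lemarié-Rieusset's shape, from
# Robinson–Rodrigo–Sadowski's Thm. 15.3

Analysis/FluidPDE proof file (no definitions, no new named facts). The tree consumes the
one-scale ε-regularity theory at the vertex of a backward cylinder — `Q_{r₀}(z₀) ⊆ Ω` with the
**open** inclusion, quantitative bound `|u| ≤ C₀ λ / r₀` a.e. on `Q_{r₀/2}(z₀)` — through the named
fact `lemarieRieusset_epsilon_regularity` (Lemarié-Rieusset 2016, Thm. 14.4, with a force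
`f ∈ L^q`, `q > 5/2`, and an arbitrary viscosity `ν > 0`). Its decomposition in the tree
(`CKNEpsilonRegularityProofs`, `CKNLocalRegularityRRS*`, `CKNLocalRegularityRRSGlueLR`) runs
through Robinson–Rodrigo–Sadowski's first local regularity theorem at unit scale,
`RRS2016.theorem15_3` (unforced) / `RRS2016.theorem15_3_force`, and needs two further steps for
the printed Thm. 14.4 (general `ν` by a covering, non-solenoidal forces by absorbing
`∇Δ⁻¹ div f` into the pressure). The **unforced** users of the criterion (`ν = 1`, `f = 0`:
Seregin 2014 Thm. 1.4, Rusin–Šverák 2011, Seregin–Šverák 2009, …) need neither step. This file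
proves, for them, the unforced criterion in Lemarié-Rieusset's shape directly from
`RRS2016.theorem15_3`:

* `unforced_epsilonRegularity_of_theorem15_3` — there are `ε₀, C₀ > 0` such that for every datum
  `(Ω, u, p, G)` satisfying the §14.3 hypotheses with `ν = 1` and `f = 0`
  (`IsLRSuitableWeakSolutionOn Ω 1 q 0 u p G`, any `q ≥ 1`), every cylinder `Q_{r₀}(z₀) ⊆ Ω` and
  every `0 ≤ λ ≤ ε₀`, `∫∫_{Q_{r₀}(z₀)} (|u|³ + |p|^{3/2}) ≤ λ³ r₀²` implies `|u| ≤ C₀ λ / r₀` a.e. on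
  `Q_{r₀/2}(z₀)`.

Proof: the Navier–Stokes scaling about `z₀` (`IsLRSuitableWeakSolutionOn.nsRescale`,
`Φ(s, y) = (t₀ + r₀² s, x₀ + r₀ y)`) turns the datum into one on `Φ⁻¹(Ω) ⊇ Q_1(0)` with the same
(zero) force and `∫∫_{Q_1(0)} (|w|³ + |π|^{3/2}) ≤ λ³`; by `IsLRSuitableWeakSolutionOn.isSuitablePair`
it is a suitable pair on `Q_1(0)` in the sense of Def. 15.2 (`RRS2016.IsSuitablePair`), so Thm. 15.3
with `ε₀ = λ³` bounds `|w| ≤ c_M λ` a.e. on `Q_{1/2}(0) = Φ⁻¹(Q_{r₀/2}(z₀))`, which transports back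
to `|u| ≤ c_M λ / r₀` (for `λ = 0` the hypothesis forces `u = 0` a.e.). This is the computation of
the accepted `lemarieRieusset_epsilon_regularity_iff_unitScale` and
`lemarieRieusset_unitScale_nu_one_divFree_of_theorem15_3_force` without the force.

## References

* J. C. Robinson, J. L. Rodrigo, W. Sadowski, *The three-dimensional Navier–Stokes equations*,
  CUP (2016), Def. 15.2, Thm. 15.3 (p. 220). [RobinsonRodrigoSadowski2016]
* P. G. Lemarié-Rieusset, *The Navier–Stokes Problem in the 21st Century*, CRC Press (2016),
  Thm. 14.4 (p. 505). [LemarieRieusset2016]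
* L. Caffarelli, R. Kohn, L. Nirenberg, Comm. Pure Appl. Math. 35 (1982), Prop. 1 and §2
  (scaling). [CaffarelliKohnNirenberg1982]
-/

noncomputable section

open MeasureTheory Set Function Filter Topology TopologicalSpace Metric
open scoped NNReal ENNReal InnerProductSpace RealInnerProductSpace Laplacian

namespace Literature.Analysis.FluidPDE

/-- `(r²)^{3/2} = r³` for `r ≥ 0` (private copy of `sq_rpow_three_halves`, `NSSuitableESS.lean`,
not imported here). [folklore] -/
private theorem sq_rpow_three_halves'' {r : ℝ} (hr : 0 ≤ r) : (r ^ 2) ^ (3 / 2 : ℝ) = r ^ 3 := by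
  rw [← Real.rpow_natCast r 2, ← Real.rpow_mul hr, ← Real.rpow_natCast r 3]
  norm_num

/-- The Navier–Stokes rescaling of the zero force is the zero force. [folklore] -/
theorem smul_stPull_zero_force (c β γ t₀ : ℝ) (x₀ : EuclideanSpace ℝ (Fin 3)) :
    c • stPull β γ t₀ x₀ (0 : ℝ → EuclideanSpace ℝ (Fin 3) → EuclideanSpace ℝ (Fin 3)) = 0 := by
  funext s y
  rw [smul_stPull_apply]
  simp

/-- **The unforced one-scale ε-regularity criterion in Lemarié-Rieusset's shape, from Thm. 15.3.**
There are `ε₀, C₀ > 0` such that: if `(Ω, u, p, G)` satisfies the standing hypotheses of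
Lemarié-Rieusset's §14.3 with `ν = 1` and `f = 0` (`IsLRSuitableWeakSolutionOn Ω 1 q 0 u p G`,
`q ≥ 1` only feeding the void class `0 ∈ L^q`), then for every backward cylinder
`Q_{r₀}(z₀) ⊆ Ω` (open inclusion: `z₀` may be a vertex of `Ω`) and every `0 ≤ λ ≤ ε₀`,
`∫∫_{Q_{r₀}(z₀)} (|u|³ + |p|^{3/2}) ≤ λ³ r₀²` implies `|u| ≤ C₀ λ / r₀` a.e. on `Q_{r₀/2}(z₀)`
(Robinson–Rodrigo–Sadowski 2016, Thm. 15.3, transported by the Navier–Stokes scaling;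
Caffarelli–Kohn–Nirenberg 1982, Prop. 1 and its Corollary). [cite: RobinsonRodrigoSadowski2016, Thm. 15.3 p. 220; LemarieRieusset2016 Thm. 14.4 p. 505 (shape of the statement)] -/
theorem unforced_epsilonRegularity_of_theorem15_3 (h : RRS2016.theorem15_3) :
    ∃ ε₀ C₀ : ℝ, 0 < ε₀ ∧ 0 < C₀ ∧
      ∀ (Q : Opens (ℝ × EuclideanSpace ℝ (Fin 3))) (q : ℝ)
        (u : ℝ → EuclideanSpace ℝ (Fin 3) → EuclideanSpace ℝ (Fin 3))
        (p : ℝ → EuclideanSpace ℝ (Fin 3) → ℝ)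
        (G : ℝ → EuclideanSpace ℝ (Fin 3) → EuclideanSpace ℝ (Fin 3) →L[ℝ] EuclideanSpace ℝ (Fin 3)),
        1 ≤ q → IsLRSuitableWeakSolutionOn Q 1 q 0 u p G →
        ∀ (z₀ : ℝ × EuclideanSpace ℝ (Fin 3)) (r₀ l : ℝ), 0 < r₀ →
          parabolicCylinder r₀ z₀ ⊆ (Q : Set (ℝ × EuclideanSpace ℝ (Fin 3))) → 0 ≤ l → l ≤ ε₀ →
          ∫⁻ w in parabolicCylinder r₀ z₀,
              (‖u w.1 w.2‖ₑ ^ (3 : ℕ) + ‖p w.1 w.2‖ₑ ^ (3 / 2 : ℝ)) ≤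
            ENNReal.ofReal (l ^ 3 * r₀ ^ 2) →
          ∀ᵐ w ∂(volume.restrict (parabolicCylinder (r₀ / 2) z₀)), ‖u w.1 w.2‖ ≤ C₀ * l / r₀ := by
  obtain ⟨ε₁, cM, hε₁, hcM, H⟩ := h
  refine ⟨ε₁ ^ (1 / 3 : ℝ), cM, Real.rpow_pos_of_pos hε₁ _, hcM, ?_⟩
  intro Q q u p G hq hS z₀ r₀ l hr₀ hsub hl0 hlε hsmall
  have hβ0 : (0 : ℝ) < r₀ ^ 2 := by positivity
  -- the rescaled datum, with zero force
  have hS' := hS.nsRescale hr₀ z₀.1 z₀.2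
  rw [smul_stPull_zero_force] at hS'
  set Φ := stAffine (r₀ ^ 2) r₀ z₀.1 z₀.2 with hΦ
  have hpre : ∀ ρ : ℝ, Φ ⁻¹' parabolicCylinder ρ z₀ =
      parabolicCylinder (ρ / r₀) (0 : ℝ × EuclideanSpace ℝ (Fin 3)) :=
    fun ρ => stAffine_sq_preimage_parabolicCylinder hr₀ z₀ ρ
  have hpre1 : Φ ⁻¹' parabolicCylinder r₀ z₀ = parabolicCylinder 1 (0 : ℝ × EuclideanSpace ℝ (Fin 3)) := by
    rw [hpre, div_self hr₀.ne']
  have hpre2 : Φ ⁻¹' parabolicCylinder (r₀ / 2) z₀ =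
      parabolicCylinder (1 / 2) (0 : ℝ × EuclideanSpace ℝ (Fin 3)) := by
    rw [hpre]
    congr 1
    field_simp
  -- the unit cylinder lies in `Φ⁻¹(Ω)`
  have h1 : parabolicCylinder 1 (0 : ℝ × EuclideanSpace ℝ (Fin 3)) ⊆
      ((stPreimage (r₀ ^ 2) r₀ z₀.1 z₀.2 Q : Opens (ℝ × EuclideanSpace ℝ (Fin 3))) :
        Set (ℝ × EuclideanSpace ℝ (Fin 3))) := by
    rw [coe_stPreimage, ← hpre1]
    exact preimage_mono hsub
  -- the rescaled datum is a suitable pair on `Q_1(0)` (Def. 15.2)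
  have hP := hS'.isSuitablePair hq (fun φ _ => by simp) h1
  -- the Jacobian factor `(r₀² · r₀³)⁻¹ = r₀⁻⁵`
  have hJ : ENNReal.ofReal (r₀ ^ 2 * r₀ ^ Module.finrank ℝ (EuclideanSpace ℝ (Fin 3)))⁻¹ =
      ENNReal.ofReal (r₀ ^ 5)⁻¹ := by
    rw [finrank_euclideanSpace_three]
    congr 1
    ring
  -- smallness of the rescaled pair on `Q_1(0)`
  have h2 : ∫⁻ w in parabolicCylinder 1 (0 : ℝ × EuclideanSpace ℝ (Fin 3)),
      (‖(r₀ • stPull (r₀ ^ 2) r₀ z₀.1 z₀.2 u) w.1 w.2‖ₑ ^ (3 : ℕ) +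
        ‖(r₀ ^ 2 • stPull (r₀ ^ 2) r₀ z₀.1 z₀.2 p) w.1 w.2‖ₑ ^ (3 / 2 : ℝ)) ≤
      ENNReal.ofReal (l ^ 3) := by
    set Fs : ℝ × EuclideanSpace ℝ (Fin 3) → ℝ≥0∞ := fun z =>
      ‖u z.1 z.2‖ₑ ^ (3 : ℕ) + ‖p z.1 z.2‖ₑ ^ (3 / 2 : ℝ) with hFs
    have hpt : ∀ w : ℝ × EuclideanSpace ℝ (Fin 3),
        ‖(r₀ • stPull (r₀ ^ 2) r₀ z₀.1 z₀.2 u) w.1 w.2‖ₑ ^ (3 : ℕ) +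
          ‖(r₀ ^ 2 • stPull (r₀ ^ 2) r₀ z₀.1 z₀.2 p) w.1 w.2‖ₑ ^ (3 / 2 : ℝ) =
        ENNReal.ofReal (r₀ ^ 3) * Fs (Φ w) := by
      intro w
      rw [smul_stPull_apply, smul_stPull_apply, enorm_smul, enorm_smul, mul_pow,
        ENNReal.mul_rpow_of_nonneg _ _ (by norm_num), Real.enorm_eq_ofReal hr₀.le,
        Real.enorm_eq_ofReal hβ0.le, ← ENNReal.ofReal_pow hr₀.le,
        ENNReal.ofReal_rpow_of_nonneg hβ0.le (by norm_num), sq_rpow_three_halves'' hr₀.le, hFs,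
        mul_add]
      rfl
    simp_rw [hpt]
    rw [lintegral_const_mul' _ _ ENNReal.ofReal_ne_top, ← hpre1,
      setLIntegral_preimage_comp_stAffine hβ0 hr₀ z₀.1 z₀.2 Fs, hJ]
    calc ENNReal.ofReal (r₀ ^ 3) *
          (ENNReal.ofReal (r₀ ^ 5)⁻¹ * ∫⁻ z in parabolicCylinder r₀ z₀, Fs z)
        ≤ ENNReal.ofReal (r₀ ^ 3) *
            (ENNReal.ofReal (r₀ ^ 5)⁻¹ * ENNReal.ofReal (l ^ 3 * r₀ ^ 2)) := by
          gcongr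
      _ = ENNReal.ofReal (l ^ 3) := by
          rw [← ENNReal.ofReal_mul (by positivity), ← ENNReal.ofReal_mul (by positivity)]
          congr 1
          field_simp
  rcases hl0.lt_or_eq with hl | hl
  · -- `λ > 0`: Thm. 15.3 with `ε₀ = λ³`
    have hl3 : 0 < l ^ 3 := pow_pos hl 3
    have hle1 : l ^ 3 ≤ ε₁ := by
      calc l ^ 3 ≤ (ε₁ ^ (1 / 3 : ℝ)) ^ 3 := pow_le_pow_left₀ hl0 hlε 3
        _ = ε₁ := by rw [← Real.rpow_natCast, ← Real.rpow_mul hε₁.le]; norm_num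
    have key := H 0 _ _ _ hP (l ^ 3) hl3 hle1 h2
    have hl13 : (l ^ 3) ^ (1 / 3 : ℝ) = l := by
      rw [← Real.rpow_natCast, ← Real.rpow_mul hl0]; norm_num
    rw [hl13, ← hpre2] at key
    have key' := ae_restrict_of_ae_restrict_preimage_stAffine hβ0 hr₀ z₀.1 z₀.2
      (S := parabolicCylinder (r₀ / 2) z₀) (P := fun z => ‖r₀ • u z.1 z.2‖ ≤ cM * l) key
    filter_upwards [key'] with z hz
    rw [norm_smul, Real.norm_eq_abs, abs_of_pos hr₀] at hz
    rw [le_div_iff₀ hr₀]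
    linarith
  · -- `λ = 0`: `u = 0` a.e. on `Q_{r₀}(z₀)`
    subst hl
    have hu : AEStronglyMeasurable (uncurry u) (volume.restrict (parabolicCylinder r₀ z₀)) :=
      (hS.weakGradient.locallyIntegrableOn.mono_set hsub).aestronglyMeasurable
    have h0 : ∫⁻ w in parabolicCylinder r₀ z₀, ‖u w.1 w.2‖ₑ ^ (3 : ℕ) = 0 := by
      refine le_antisymm ?_ bot_le
      calc ∫⁻ w in parabolicCylinder r₀ z₀, ‖u w.1 w.2‖ₑ ^ (3 : ℕ)
          ≤ ∫⁻ w in parabolicCylinder r₀ z₀,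
              (‖u w.1 w.2‖ₑ ^ (3 : ℕ) + ‖p w.1 w.2‖ₑ ^ (3 / 2 : ℝ)) :=
            lintegral_mono fun w => le_self_add
        _ ≤ ENNReal.ofReal ((0 : ℝ) ^ 3 * r₀ ^ 2) := hsmall
        _ = 0 := by norm_num
    have hae : ∀ᵐ w ∂(volume.restrict (parabolicCylinder r₀ z₀)), ‖u w.1 w.2‖ₑ ^ (3 : ℕ) = 0 :=
      (lintegral_eq_zero_iff' (hu.enorm.pow_const _)).1 h0
    have hae' : ∀ᵐ w ∂(volume.restrict (parabolicCylinder (r₀ / 2) z₀)),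
        ‖u w.1 w.2‖ₑ ^ (3 : ℕ) = 0 :=
      ae_restrict_of_ae_restrict_of_subset
        (parabolicCylinder_mono (by positivity) (by linarith) z₀) hae
    filter_upwards [hae'] with w hw
    have : ‖u w.1 w.2‖ₑ = 0 := by
      by_contra hne
      exact absurd hw (pow_ne_zero 3 hne)
    rw [enorm_eq_zero] at this
    rw [this, norm_zero, mul_zero, zero_div]

end Literature.Analysis.FluidPDE

end
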